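import Literature.MathematicalPhysics.QuantumManyBody.PeriodicHeatFlow
import Literature.MathematicalPhysics.QuantumManyBody.BoseGasThermodynamicLimitProofs
import Mathlib.MeasureTheory.Function.Floor
import HarnessLib

/-!
# Periodic Feynman–Kac: reduction to the fundamental cell and the free `L¹(cell) → L^∞` bound

Topic `Literature/MathematicalPhysics/QuantumManyBody`; first support file of the proof of the named
fact `Literature.MathematicalPhysics.QuantumManyBody.BoseGas.PeriodicGroundStateFeynmanKac`
(`PeriodicHeatFlowSpectral.lean`), the torus twin of the Dirichlet development
`GroundStateFeynmanKac*.lean`. The torus `((ℝ/Lℤ)³)^N` is handled on the covering space `(ℝ³)^N`: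
periodic functions are the functions on the torus, the fundamental cell `cellN N L = [0,L)^{3N}`
carries its Haar (= Lebesgue) measure, and the Brownian motion of the flat torus is read along the
world-lines `X + √2 b_t` of `GroundStateFeynmanKac.lean` (Chung–Zhao (1995) §3.2: a Hunt process
with a symmetric bounded transition density on a space of finite measure). This file provides the
two pieces of bookkeeping every later step uses:

* `cellProj L X = X - L⌊X/L⌋ ∈ [0,L)^{3N}` — the reduction modulo the period lattice `(Lℤ³)^N`
  (through `cellIndex`/`latticeVecN` of `BoseGasThermodynamicLimitProofs.lean`): measurable, the
  identity on the cell, invariant under the lattice; a function periodic in every generator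
  `L e_{i,k}` is periodic under the whole lattice (`apply_add_latticeVecN_of_periodic`) and factors
  through `cellProj` (`comp_cellProj_eq_self`); `g ∘ cellProj L` is the periodic extension of
  `g|_cell`; and **null sets of the cell lift to null sets of the covering space**
  (`ae_comp_cellProj`: a.e.-statements on `L²(cell)`-classes become a.e.-statements for their
  periodic extensions, so the Feynman–Kac functional at positive time does not see the choice of
  representative, `periodicFKSemigroup_congr_ae`).
* **The free `L¹(cell) → L^∞` bound** (Chung–Zhao Thm 3.10, Step 4, for the torus: the transition
  density of the flat torus — the periodised Gaussian — is bounded): for measurable periodic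
  `G ≥ 0` and `t > 0`,
  `E[G(X + √2 b_t)] ≤ pHeatConst N L t · ∫_{cell} G` (`lintegral_worldLine_le_cell`), proved
  WITHOUT lattice sums by the Gaussian comparison
  `p_t(X, Y) ≤ (√2 e^{L²/4t})^{3N} p_{2t}(X, Y - W)` for every `W ∈ [0,L)^{3N}`
  (`heatKernel_le_heatKernel_two_mul_sub`), i.e. `E[G(B_t)] ≤ K E[G(B_{2t} + W)]`, averaged over
  `W ∈ cell` with the shift invariance of cell integrals of periodic functions
  (`lintegral_cellN_comp_add`); whence the `L²(cell) → L^∞` bound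
  (`lintegral_worldLine_le_L2cell`) and the finiteness of `periodicFKSemigroup v L t g X` for
  periodic `g ∈ L²(cell)` (`periodicFKSemigroup_lt_top_of_cell`).

## References

* K. L. Chung, Z. Zhao, *From Brownian Motion to Schrödinger's Equation* (1995), §3.2 (25)–(28),
  Thm 3.10 (Steps 1, 4). [ChungZhao1995]
* M. I. Freidlin, *Functional Integration and Partial Differential Equations* (1985), Ch. VII
  §7.2 (the periodic-coefficient semigroup on periodic functions is the torus semigroup).

## Design

No named fact. Two definitions: `cellProj` (a plain function on configurations) and the constant
`pHeatConst N L t ∈ [0, ∞]` (kept in product form, as `heatConst` of the Dirichlet files).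
Periodicity hypotheses are spelled out on the generators, `∀ X i k, g (X + L e_{i,k}) = g X`, as in
`PeriodicHeatFlow.lean` and `PeriodicHeatFlowSpectral.lean`.
-/

noncomputable section

namespace Literature.MathematicalPhysics.QuantumManyBody.BoseGas

open MeasureTheory ProbabilityTheory Filter Set
open scoped ENNReal NNReal Topology
open Literature.Probability.Process

variable {N : ℕ}

/-! ### Periodicity under the whole lattice -/

/-- The lattice vector of a one-entry integer matrix is an integer multiple of a generator:
`L · (z δ_{i,k}) = z • L e_{i,k}`. [folklore] -/
theorem latticeVecN_single_single (L : ℝ) (i : Fin N) (k : Fin 3) (z : ℤ) :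
    latticeVecN L (Pi.single i (Pi.single k z)) =
      z • (Pi.single i (EuclideanSpace.single k L) : Config N) := by
  ext j l
  rw [latticeVecN_apply]
  simp only [Pi.smul_apply, WithLp.ofLp_smul]
  by_cases hj : j = i
  · subst hj
    simp only [Pi.single_eq_same]
    by_cases hl : l = k
    · subst hl
      simp [zsmul_eq_mul, mul_comm]
    · simp [hl]
  · simp [hj]

/-- **A function periodic in every generator `L e_{i,k}` is periodic under the whole lattice
`(Lℤ³)^N`.** [folklore] -/
theorem apply_add_latticeVecN_of_periodic {β : Type*} {L : ℝ} {g : Config N → β}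
    (hper : ∀ (X : Config N) (i : Fin N) (k : Fin 3),
      g (X + Pi.single i (EuclideanSpace.single k L)) = g X)
    (X : Config N) (m : Fin N → Fin 3 → ℤ) : g (X + latticeVecN L m) = g X := by
  classical
  -- one entry at a time: integer multiples of a generator
  have hz : ∀ (Y : Config N) (i : Fin N) (k : Fin 3) (z : ℤ),
      g (Y + latticeVecN L (Pi.single i (Pi.single k z))) = g Y := by
    intro Y i k z
    rw [latticeVecN_single_single]
    exact (show Function.Periodic g (Pi.single i (EuclideanSpace.single k L)) from
      fun Z => hper Z i k).zsmul z Y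
  -- one particle: `m i = ∑ k, δ_k (m i k)`
  have hrow : ∀ (Y : Config N) (i : Fin N) (n : Fin 3 → ℤ),
      g (Y + latticeVecN L (Pi.single i n)) = g Y := by
    intro Y i n
    have hn : n = ∑ k, Pi.single k (n k) := (Finset.univ_sum_single n).symm
    rw [hn]
    induction (Finset.univ : Finset (Fin 3)) using Finset.induction_on generalizing Y with
    | empty => simp
    | insert a s ha ih =>
      rw [Finset.sum_insert ha, Pi.single_add, latticeVecN_add, ← add_assoc, add_comm Y,
        add_assoc]
      rw [add_comm (latticeVecN L _) (Y + _)]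
      rw [hz, ih]
  -- all particles: `m = ∑ i, δ_i (m i)`
  have hm : m = ∑ i, Pi.single i (m i) := (Finset.univ_sum_single m).symm
  rw [hm]
  induction (Finset.univ : Finset (Fin N)) using Finset.induction_on generalizing X with
  | empty => simp
  | insert a s ha ih =>
    rw [Finset.sum_insert ha, latticeVecN_add, ← add_assoc, add_comm X, add_assoc,
      add_comm (latticeVecN L _) (X + _), hrow, ih]

/-! ### Reduction to the fundamental cell -/

/-- **Reduction modulo the period lattice**: `cellProj L X = X - L⌊X/L⌋`, the representative of
`X` in the fundamental cell `[0,L)^{3N}` of `(Lℤ³)^N` (for `L > 0`). [folklore] -/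
def cellProj (L : ℝ) (X : Config N) : Config N := X - latticeVecN L (cellIndex L X)

/-- `cellProj L X ∈ [0,L)^{3N}`. [folklore] -/
theorem cellProj_mem_cellN {L : ℝ} (hL : 0 < L) (X : Config N) : cellProj L X ∈ cellN N L :=
  sub_latticeVecN_cellIndex_mem_cellN hL X

/-- On the cell, `cellProj` is the identity. [folklore] -/
theorem cellProj_of_mem_cellN {L : ℝ} (hL : 0 < L) {X : Config N} (hX : X ∈ cellN N L) :
    cellProj L X = X := by
  simp [cellProj, cellIndex_eq_zero_of_mem_cellN hL hX]

/-- `cellProj` is invariant under the lattice. [folklore] -/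
theorem cellProj_add_latticeVecN {L : ℝ} (hL : L ≠ 0) (X : Config N) (m : Fin N → Fin 3 → ℤ) :
    cellProj L (X + latticeVecN L m) = cellProj L X := by
  simp only [cellProj, cellIndex_add_latticeVecN hL, latticeVecN_add]
  abel

/-- `cellProj` is invariant under the generators `L e_{i,k}`. [folklore] -/
theorem cellProj_add_single {L : ℝ} (hL : L ≠ 0) (X : Config N) (i : Fin N) (k : Fin 3) :
    cellProj L (X + Pi.single i (EuclideanSpace.single k L)) = cellProj L X := by
  rw [single_single_eq_latticeVecN, cellProj_add_latticeVecN hL]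

/-- `X` and its reduction differ by a lattice vector: `X = cellProj L X + L·cellIndex L X`.
[folklore] -/
theorem cellProj_add_latticeVecN_cellIndex (L : ℝ) (X : Config N) :
    cellProj L X + latticeVecN L (cellIndex L X) = X :=
  sub_add_cancel X _

/-- The cell index is measurable. [folklore] -/
theorem measurable_cellIndex (L : ℝ) : Measurable (cellIndex (N := N) L) := by
  refine measurable_pi_lambda _ fun i => measurable_pi_lambda _ fun k => ?_
  have hc : Measurable fun X : Config N => X i k / L := by fun_prop
  exact Int.measurable_floor.comp hc

/-- `cellProj` is measurable. [folklore] -/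
theorem measurable_cellProj (L : ℝ) : Measurable (cellProj (N := N) L) :=
  measurable_id.sub ((measurable_of_countable (latticeVecN (N := N) L)).comp
    (measurable_cellIndex L))

/-- **The periodic extension**: `g ∘ cellProj L` is periodic in every generator. [folklore] -/
theorem comp_cellProj_periodic {β : Type*} {L : ℝ} (hL : L ≠ 0) (g : Config N → β)
    (X : Config N) (i : Fin N) (k : Fin 3) :
    (g ∘ cellProj L) (X + Pi.single i (EuclideanSpace.single k L)) = (g ∘ cellProj L) X := by
  simp only [Function.comp_apply, cellProj_add_single hL]

/-- **A periodic function factors through the reduction**: `g (cellProj L X) = g X`. [folklore] -/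
theorem apply_cellProj_of_periodic {β : Type*} {L : ℝ} {g : Config N → β}
    (hper : ∀ (X : Config N) (i : Fin N) (k : Fin 3),
      g (X + Pi.single i (EuclideanSpace.single k L)) = g X)
    (X : Config N) : g (cellProj L X) = g X := by
  conv_rhs => rw [← cellProj_add_latticeVecN_cellIndex L X]
  exact (apply_add_latticeVecN_of_periodic hper _ _).symm

/-- A periodic function IS the periodic extension of its restriction to the cell. [folklore] -/
theorem comp_cellProj_eq_self {β : Type*} {L : ℝ} {g : Config N → β}
    (hper : ∀ (X : Config N) (i : Fin N) (k : Fin 3),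
      g (X + Pi.single i (EuclideanSpace.single k L)) = g X) :
    g ∘ cellProj L = g :=
  funext fun X => apply_cellProj_of_periodic hper X

/-- On the cell the periodic extension is the function. [folklore] -/
theorem comp_cellProj_apply_of_mem {β : Type*} {L : ℝ} (hL : 0 < L) (g : Config N → β)
    {X : Config N} (hX : X ∈ cellN N L) : (g ∘ cellProj L) X = g X := by
  simp only [Function.comp_apply, cellProj_of_mem_cellN hL hX]

/-- The periodic extension of a measurable function is measurable. [folklore] -/
theorem Measurable.comp_cellProj {β : Type*} [MeasurableSpace β] {L : ℝ} {g : Config N → β}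
    (hg : Measurable g) : Measurable (g ∘ cellProj L) :=
  hg.comp (measurable_cellProj L)

/-! ### Null sets of the cell lift to the covering space -/

/-- **An a.e.-property on the cell holds a.e. along the reduction**: if `p` holds for a.e. point of
`[0,L)^{3N}`, then `p (cellProj L X)` for a.e. `X ∈ (ℝ³)^N` (the exceptional set is covered by the
countably many lattice translates of a null set). [folklore] -/
theorem ae_cellProj {L : ℝ} (hL : 0 < L) {p : Config N → Prop}
    (h : ∀ᵐ Y ∂(volume.restrict (cellN N L)), p Y) : ∀ᵐ X ∂(volume : Measure (Config N)),
      p (cellProj L X) := by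
  rw [ae_restrict_iff' (measurableSet_cellN N L)] at h
  rw [ae_iff] at h ⊢
  -- the bad set upstairs is covered by the translates of the bad set of the cell
  have hsub : {X : Config N | ¬ p (cellProj L X)} ⊆
      ⋃ m : Fin N → Fin 3 → ℤ, (fun X : Config N => X + -latticeVecN L m) ⁻¹'
        {Y : Config N | ¬ (Y ∈ cellN N L → p Y)} := by
    intro X hX
    simp only [Set.mem_iUnion, Set.mem_preimage, Set.mem_setOf_eq, Classical.not_imp]
    exact ⟨cellIndex L X, by simpa [cellProj, sub_eq_add_neg] using cellProj_mem_cellN hL X,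
      by simpa [cellProj, sub_eq_add_neg] using hX⟩
  refine measure_mono_null hsub (measure_iUnion_null fun m => ?_)
  rw [measure_preimage_add_right]
  exact h

/-- **Null modifications on the cell are null modifications of the periodic extensions.**
[folklore] -/
theorem ae_comp_cellProj {β : Type*} {L : ℝ} (hL : 0 < L) {g g' : Config N → β}
    (h : g =ᵐ[volume.restrict (cellN N L)] g') :
    g ∘ cellProj L =ᵐ[(volume : Measure (Config N))] g' ∘ cellProj L :=
  ae_cellProj hL h

/-- Two periodic functions that agree a.e. on the cell agree a.e. [folklore] -/
theorem ae_eq_of_periodic_of_ae_eq_cellN {β : Type*} {L : ℝ} (hL : 0 < L) {g g' : Config N → β}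
    (hg : ∀ (X : Config N) (i : Fin N) (k : Fin 3),
      g (X + Pi.single i (EuclideanSpace.single k L)) = g X)
    (hg' : ∀ (X : Config N) (i : Fin N) (k : Fin 3),
      g' (X + Pi.single i (EuclideanSpace.single k L)) = g' X)
    (h : g =ᵐ[volume.restrict (cellN N L)] g') : g =ᵐ[(volume : Measure (Config N))] g' := by
  have h1 := ae_comp_cellProj hL h
  rwa [comp_cellProj_eq_self hg, comp_cellProj_eq_self hg'] at h1

/-- **A null modification of the observable does not change the periodic Feynman–Kac functional**
(`t > 0`: the law of `B_t` is absolutely continuous). [folklore] -/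
theorem periodicFKSemigroup_congr_ae (v : ℝ → ℝ≥0∞) (L : ℝ) {t : ℝ} (ht : 0 < t)
    {g g' : Config N → ℝ≥0∞} (h : g =ᵐ[volume] g') (X : Config N) :
    periodicFKSemigroup v L t g X = periodicFKSemigroup v L t g' X := by
  refine lintegral_congr_ae ?_
  filter_upwards [comp_worldLine_ae_eq X (t := t.toNNReal) (by simpa using ht) h] with ω hω
  rw [hω]

/-- The cell version: periodic observables that agree a.e. on the cell have the same functional
(`t > 0`, `L > 0`). [folklore] -/
theorem periodicFKSemigroup_congr_ae_cellN (v : ℝ → ℝ≥0∞) {L : ℝ} (hL : 0 < L) {t : ℝ}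
    (ht : 0 < t) {g g' : Config N → ℝ≥0∞}
    (hg : ∀ (X : Config N) (i : Fin N) (k : Fin 3),
      g (X + Pi.single i (EuclideanSpace.single k L)) = g X)
    (hg' : ∀ (X : Config N) (i : Fin N) (k : Fin 3),
      g' (X + Pi.single i (EuclideanSpace.single k L)) = g' X)
    (h : g =ᵐ[volume.restrict (cellN N L)] g') (X : Config N) :
    periodicFKSemigroup v L t g X = periodicFKSemigroup v L t g' X :=
  periodicFKSemigroup_congr_ae v L ht (ae_eq_of_periodic_of_ae_eq_cellN hL hg hg' h) X

/-! ### The Gaussian comparison -/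

/-- **One-dimensional Gaussian comparison**: for `|w| ≤ M`,
`g_{2t}(x - μ) ≤ √2 e^{M²/4t} g_{4t}(x - w - μ)` (from `(a - w)² ≤ 2a² + 2M²`), densities of
variances `2t` and `4t`. [folklore] -/
theorem gaussianPDFReal_le_sqrt_two_mul (μ : ℝ) (t : ℝ≥0) (x w : ℝ) {M : ℝ} (hw : |w| ≤ M) :
    gaussianPDFReal μ (2 * t) x ≤
      Real.sqrt 2 * Real.exp (M ^ 2 / (4 * t)) * gaussianPDFReal μ (2 * (2 * t)) (x - w) := by
  rcases eq_or_ne t 0 with rfl | ht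
  · simp [gaussianPDFReal]
  have ht0 : (0 : ℝ) < t := lt_of_le_of_ne t.2 (fun h => ht (NNReal.coe_eq_zero.1 h.symm))
  simp only [gaussianPDFReal, NNReal.coe_mul, NNReal.coe_ofNat]
  -- prefactors: `(√(4πt))⁻¹ = √2 · (√(8πt))⁻¹`
  have hpre : (Real.sqrt (2 * Real.pi * (2 * t)))⁻¹ =
      Real.sqrt 2 * (Real.sqrt (2 * Real.pi * (2 * (2 * t))))⁻¹ := by
    have h8 : Real.sqrt (2 * Real.pi * (2 * (2 * t))) = Real.sqrt 2 * Real.sqrt (2 * Real.pi * (2 * t)) := by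
      rw [← Real.sqrt_mul (by norm_num : (0:ℝ) ≤ 2)]
      congr 1; ring
    have hs : Real.sqrt 2 ≠ 0 := by positivity
    rw [h8, mul_inv, mul_inv_cancel_left₀ hs]
  -- exponents
  have hexp : Real.exp (-(x - μ) ^ 2 / (2 * (2 * t))) ≤
      Real.exp (M ^ 2 / (4 * t)) * Real.exp (-(x - w - μ) ^ 2 / (2 * (2 * (2 * t)))) := by
    rw [← Real.exp_add]
    refine Real.exp_le_exp.2 ?_
    have hsq : (x - w - μ) ^ 2 ≤ 2 * (x - μ) ^ 2 + 2 * M ^ 2 := by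
      have hwM : w ^ 2 ≤ M ^ 2 := by
        rw [← sq_abs w]
        exact pow_le_pow_left₀ (abs_nonneg w) hw 2
      nlinarith [sq_nonneg (x - μ + w)]
    have key : M ^ 2 / (4 * t) + -(x - w - μ) ^ 2 / (2 * (2 * (2 * t))) -
        (-(x - μ) ^ 2 / (2 * (2 * t))) = (2 * M ^ 2 + 2 * (x - μ) ^ 2 - (x - w - μ) ^ 2) / (8 * t) := by
      field_simp
      ring
    refine sub_nonneg.1 ?_
    rw [key]
    exact div_nonneg (by linarith [hsq]) (by positivity)
  have hpos : 0 ≤ (Real.sqrt (2 * Real.pi * (2 * (2 * t))))⁻¹ := by positivity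
  calc (Real.sqrt (2 * Real.pi * (2 * ↑t)))⁻¹ * Real.exp (-(x - μ) ^ 2 / (2 * (2 * ↑t)))
      = Real.sqrt 2 * (Real.sqrt (2 * Real.pi * (2 * (2 * t))))⁻¹ *
          Real.exp (-(x - μ) ^ 2 / (2 * (2 * ↑t))) := by rw [hpre]
    _ ≤ Real.sqrt 2 * (Real.sqrt (2 * Real.pi * (2 * (2 * t))))⁻¹ *
          (Real.exp (M ^ 2 / (4 * t)) * Real.exp (-(x - w - μ) ^ 2 / (2 * (2 * (2 * t))))) :=
        mul_le_mul_of_nonneg_left hexp (by positivity)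
    _ = _ := by ring

/-- **Gaussian comparison for the free heat kernel**: for a shift `W` with `|W_{ik}| ≤ M`,
`p_t(X, Y) ≤ (√2 e^{M²/4t})^{3N} p_{2t}(X, Y - W)` (product of the one-dimensional comparisons;
the constant in product form). [folklore] -/
theorem heatKernel_le_heatKernel_two_mul_sub (X Y : Config N) (t : ℝ≥0) {W : Config N} {M : ℝ}
    (hW : ∀ i k, |W i k| ≤ M) :
    (∏ i, ∏ k, gaussianPDF (X i k) (2 * t) (Y i k)) ≤
      (∏ _i : Fin N, ∏ _k : Fin 3, ENNReal.ofReal (Real.sqrt 2 * Real.exp (M ^ 2 / (4 * t)))) *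
        ∏ i, ∏ k, gaussianPDF (X i k) (2 * (2 * t)) ((Y - W) i k) := by
  rw [← Finset.prod_mul_distrib]
  refine Finset.prod_le_prod' fun i _ => ?_
  rw [← Finset.prod_mul_distrib]
  refine Finset.prod_le_prod' fun k _ => ?_
  rw [gaussianPDF, gaussianPDF, ← ENNReal.ofReal_mul (by positivity)]
  refine ENNReal.ofReal_le_ofReal ?_
  have h := gaussianPDFReal_le_sqrt_two_mul (X i k) t (Y i k) (W i k) (hW i k)
  simpa only [Pi.sub_apply, WithLp.ofLp_sub] using h

/-- **The free expectation is dominated by the shifted free expectation at double time**: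
`E[G(B_t)] ≤ (√2 e^{M²/4t})^{3N} E[G(B_{2t} + W)]` for `|W_{ik}| ≤ M`, measurable `G ≥ 0`, `t > 0`
(Gaussian comparison and translation invariance of Lebesgue measure). [folklore] -/
theorem lintegral_worldLine_le_shift (X W : Config N) {t : ℝ≥0} (ht : t ≠ 0) {M : ℝ}
    (hW : ∀ i k, |W i k| ≤ M) {G : Config N → ℝ≥0∞} (hG : Measurable G) :
    ∫⁻ ω, G (worldLine X ω t) ∂wienerPaths N ≤
      (∏ _i : Fin N, ∏ _k : Fin 3, ENNReal.ofReal (Real.sqrt 2 * Real.exp (M ^ 2 / (4 * t)))) *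
        ∫⁻ ω, G (worldLine X ω (2 * t) + W) ∂wienerPaths N := by
  set K : ℝ≥0∞ := ∏ _i : Fin N, ∏ _k : Fin 3,
    ENNReal.ofReal (Real.sqrt 2 * Real.exp (M ^ 2 / (4 * t))) with hK
  have hKtop : K ≠ ⊤ := by
    refine ne_of_lt (ENNReal.prod_lt_top fun i _ => ENNReal.prod_lt_top fun k _ => ?_)
    exact ENNReal.ofReal_lt_top
  have h2t : (2 : ℝ≥0) * t ≠ 0 := mul_ne_zero two_ne_zero ht
  have hGW : Measurable fun Y : Config N => G (Y + W) := hG.comp (measurable_id.add_const W)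
  rw [lintegral_worldLine_eq X ht hG, lintegral_worldLine_eq X h2t hGW]
  calc ∫⁻ Y : Config N, (∏ i, ∏ k, gaussianPDF (X i k) (2 * t) (Y i k)) * G Y
      ≤ ∫⁻ Y : Config N, (K * ∏ i, ∏ k, gaussianPDF (X i k) (2 * (2 * t)) ((Y - W) i k)) * G Y :=
        lintegral_mono fun Y => mul_le_mul' (heatKernel_le_heatKernel_two_mul_sub X Y t hW) le_rfl
    _ = K * ∫⁻ Y : Config N, (∏ i, ∏ k, gaussianPDF (X i k) (2 * (2 * t)) ((Y - W) i k)) * G Y := by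
        rw [← lintegral_const_mul' _ _ hKtop]
        simp only [mul_assoc]
    _ = K * ∫⁻ Y : Config N, (∏ i, ∏ k, gaussianPDF (X i k) (2 * (2 * t)) (Y i k)) * G (Y + W) := by
        congr 1
        rw [← lintegral_add_right_eq_self (μ := (volume : Measure (Config N)))
          (fun Y : Config N => (∏ i, ∏ k, gaussianPDF (X i k) (2 * (2 * t)) ((Y - W) i k)) * G Y) W]
        simp only [add_sub_cancel_right]

/-! ### The free `L¹(cell) → L^∞` bound -/

/-- The constant of the free `L¹(cell) → L^∞` bound on the torus of side `L` at time `t`: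
`|[0,L)^{3N}|⁻¹ (√2 e^{L²/4t})^{3N}` (product form; a bound for the periodised heat kernel).
[folklore] -/
def pHeatConst (N : ℕ) (L : ℝ) (t : ℝ≥0) : ℝ≥0∞ :=
  ((ENNReal.ofReal L ^ 3) ^ N)⁻¹ *
    ∏ _i : Fin N, ∏ _k : Fin 3, ENNReal.ofReal (Real.sqrt 2 * Real.exp (L ^ 2 / (4 * t)))

/-- The constant is finite for `L > 0`. [folklore] -/
theorem pHeatConst_lt_top (N : ℕ) {L : ℝ} (hL : 0 < L) (t : ℝ≥0) : pHeatConst N L t < ⊤ := by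
  unfold pHeatConst
  refine ENNReal.mul_lt_top ?_ ?_
  · rw [ENNReal.inv_lt_top, pos_iff_ne_zero]
    exact pow_ne_zero _ (pow_ne_zero _ (by simpa using hL))
  · exact ENNReal.prod_lt_top fun i _ => ENNReal.prod_lt_top fun k _ => ENNReal.ofReal_lt_top

/-- The constant is finite for `L > 0`. [folklore] -/
theorem pHeatConst_ne_top (N : ℕ) {L : ℝ} (hL : 0 < L) (t : ℝ≥0) : pHeatConst N L t ≠ ⊤ :=
  (pHeatConst_lt_top N hL t).ne

/-- The constant is non-increasing in time: for `0 < t₀ ≤ τ`, `pHeatConst N L τ ≤ pHeatConst N L t₀`.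
[folklore] -/
theorem pHeatConst_antitone (N : ℕ) (L : ℝ) {t₀ τ : ℝ≥0} (ht₀ : t₀ ≠ 0) (h : t₀ ≤ τ) :
    pHeatConst N L τ ≤ pHeatConst N L t₀ := by
  unfold pHeatConst
  refine mul_le_mul' le_rfl (Finset.prod_le_prod' fun i _ => Finset.prod_le_prod' fun k _ => ?_)
  refine ENNReal.ofReal_le_ofReal (mul_le_mul_of_nonneg_left (Real.exp_le_exp.2 ?_)
    (Real.sqrt_nonneg _))
  have ht₀' : (0 : ℝ) < t₀ := lt_of_le_of_ne t₀.2 (fun h' => ht₀ (NNReal.coe_eq_zero.1 h'.symm))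
  have h' : (t₀ : ℝ) ≤ τ := h
  exact div_le_div_of_nonneg_left (sq_nonneg L) (by positivity) (by linarith)

/-- The cell has positive finite volume `L^{3N}` for `L > 0`. [folklore] -/
theorem volume_cellN_ne_zero (N : ℕ) {L : ℝ} (hL : 0 < L) : volume (cellN N L) ≠ 0 := by
  rw [volume_cellN]
  exact pow_ne_zero _ (pow_ne_zero _ (by simpa using hL))

/-- The cell has finite volume. [folklore] -/
theorem volume_cellN_ne_top (N : ℕ) (L : ℝ) : volume (cellN N L) ≠ ⊤ := by
  rw [volume_cellN]
  exact ENNReal.pow_ne_top (ENNReal.pow_ne_top ENNReal.ofReal_ne_top)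

/-- **The free `L¹(cell) → L^∞` bound on the torus** (Chung–Zhao (1995), Thm 3.10 Step 4, for the
Brownian motion of the flat torus, whose transition density is bounded): for `L > 0`, `t > 0` and a
measurable `G ≥ 0` periodic in every particle,
`E[G(X + √2 b_t)] ≤ pHeatConst N L t · ∫_{[0,L)^{3N}} G`, uniformly in `X`. Proof: average the
shifted comparison `E[G(B_t)] ≤ K E[G(B_{2t} + W)]` over `W ∈ [0,L)^{3N}` and use the shift
invariance of cell integrals of periodic functions. [cite: ChungZhao1995, Thm 3.10] -/
theorem lintegral_worldLine_le_cell {L : ℝ} (hL : 0 < L) (X : Config N) {t : ℝ≥0} (ht : t ≠ 0)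
    {G : Config N → ℝ≥0∞} (hG : Measurable G)
    (hper : ∀ (Y : Config N) (i : Fin N) (k : Fin 3),
      G (Y + Pi.single i (EuclideanSpace.single k L)) = G Y) :
    ∫⁻ ω, G (worldLine X ω t) ∂wienerPaths N ≤ pHeatConst N L t * ∫⁻ Y in cellN N L, G Y := by
  set K : ℝ≥0∞ := ∏ _i : Fin N, ∏ _k : Fin 3,
    ENNReal.ofReal (Real.sqrt 2 * Real.exp (L ^ 2 / (4 * t))) with hK
  set I : ℝ≥0∞ := ∫⁻ ω, G (worldLine X ω t) ∂wienerPaths N with hI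
  set V : ℝ≥0∞ := volume (cellN N L) with hV
  have hV0 : V ≠ 0 := volume_cellN_ne_zero N hL
  have hVtop : V ≠ ⊤ := volume_cellN_ne_top N L
  -- the shifted comparison, for every `W` in the cell
  have hshift : ∀ W ∈ cellN N L, I ≤ K * ∫⁻ ω, G (worldLine X ω (2 * t) + W) ∂wienerPaths N := by
    intro W hW
    refine lintegral_worldLine_le_shift X W ht (M := L) (fun i k => ?_) hG
    have h := hW i k
    rw [abs_le]
    exact ⟨by linarith [h.1], h.2.le⟩
  -- integrate over `W ∈ cell`
  have hmeas : Measurable (Function.uncurry fun (W : Config N) (ω : PathSpace N) =>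
      G (worldLine X ω (2 * t) + W)) :=
    hG.comp (((measurable_worldLine X _).comp measurable_snd).add measurable_fst)
  have hint : V * I ≤ K * ∫⁻ Y in cellN N L, G Y := by
    calc V * I = ∫⁻ _W in cellN N L, I := by
          rw [lintegral_const, Measure.restrict_apply_univ, mul_comm]
      _ ≤ ∫⁻ W in cellN N L, K * ∫⁻ ω, G (worldLine X ω (2 * t) + W) ∂wienerPaths N :=
          setLIntegral_mono' (measurableSet_cellN N L) fun W hW => hshift W hW
      _ = K * ∫⁻ W in cellN N L, ∫⁻ ω, G (worldLine X ω (2 * t) + W) ∂wienerPaths N := by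
          rw [lintegral_const_mul _ hmeas.lintegral_prod_right]
      _ = K * ∫⁻ ω, ∫⁻ W in cellN N L, G (worldLine X ω (2 * t) + W) ∂volume ∂wienerPaths N := by
          rw [lintegral_lintegral_swap hmeas.aemeasurable]
      _ = K * ∫⁻ _ω, ∫⁻ W in cellN N L, G W ∂volume ∂wienerPaths N := by
          congr 1
          refine lintegral_congr fun ω => ?_
          have h := lintegral_cellN_comp_add hL hper (worldLine X ω (2 * t))
          simpa only [add_comm] using h
      _ = K * ∫⁻ Y in cellN N L, G Y := by
          rw [lintegral_const, measure_univ, mul_one]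
  calc I = V⁻¹ * (V * I) := by rw [← mul_assoc, ENNReal.inv_mul_cancel hV0 hVtop, one_mul]
    _ ≤ V⁻¹ * (K * ∫⁻ Y in cellN N L, G Y) := mul_le_mul' le_rfl hint
    _ = pHeatConst N L t * ∫⁻ Y in cellN N L, G Y := by
        rw [← mul_assoc, hV, volume_cellN]
        rfl

/-- **Cauchy–Schwarz on the cell**: `∫_cell G ≤ |cell|^{1/2} (∫_cell G²)^{1/2}`. [folklore] -/
theorem setLIntegral_cellN_le_L2 (L : ℝ) {G : Config N → ℝ≥0∞}
    (hG : AEMeasurable G (volume.restrict (cellN N L))) :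
    ∫⁻ Y in cellN N L, G Y ≤
      volume (cellN N L) ^ (1 / 2 : ℝ) * (∫⁻ Y in cellN N L, G Y ^ (2 : ℝ)) ^ (1 / 2 : ℝ) := by
  have hcs := ENNReal.lintegral_mul_le_Lp_mul_Lq (volume.restrict (cellN N L))
    Real.HolderConjugate.two_two aemeasurable_const hG (f := fun _ => 1)
  simp only [Pi.mul_apply, one_mul, ENNReal.one_rpow, lintegral_const,
    Measure.restrict_apply_univ] at hcs
  simpa using hcs

/-- **The free `L²(cell) → L^∞` bound on the torus**: for periodic measurable `G ≥ 0`, `t > 0`,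
`E[G(X + √2 b_t)] ≤ pHeatConst N L t · |cell|^{1/2} · ‖G‖_{L²(cell)}` (Chung–Zhao (1995),
Thm 3.10: `T_t` is bounded from `L²` to `L^∞`). [cite: ChungZhao1995, Thm 3.10] -/
theorem lintegral_worldLine_le_L2cell {L : ℝ} (hL : 0 < L) (X : Config N) {t : ℝ≥0} (ht : t ≠ 0)
    {G : Config N → ℝ≥0∞} (hG : Measurable G)
    (hper : ∀ (Y : Config N) (i : Fin N) (k : Fin 3),
      G (Y + Pi.single i (EuclideanSpace.single k L)) = G Y) :
    ∫⁻ ω, G (worldLine X ω t) ∂wienerPaths N ≤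
      pHeatConst N L t * volume (cellN N L) ^ (1 / 2 : ℝ) *
        (∫⁻ Y in cellN N L, G Y ^ (2 : ℝ)) ^ (1 / 2 : ℝ) := by
  calc ∫⁻ ω, G (worldLine X ω t) ∂wienerPaths N ≤ pHeatConst N L t * ∫⁻ Y in cellN N L, G Y :=
        lintegral_worldLine_le_cell hL X ht hG hper
    _ ≤ pHeatConst N L t * (volume (cellN N L) ^ (1 / 2 : ℝ) *
          (∫⁻ Y in cellN N L, G Y ^ (2 : ℝ)) ^ (1 / 2 : ℝ)) :=
        mul_le_mul' le_rfl (setLIntegral_cellN_le_L2 L hG.aemeasurable)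
    _ = _ := by rw [mul_assoc]

/-! ### Consequences for the periodic Feynman–Kac functional -/

/-- **`L¹(cell) → L^∞` bound for the periodic Feynman–Kac functional** (weights `≤ 1`): for
periodic measurable `g ≥ 0` and `t > 0`, `(e^{-tH} g)(X) ≤ pHeatConst N L t · ∫_cell g`.
[cite: ChungZhao1995, Thm 3.10] -/
theorem periodicFKSemigroup_le_cell (v : ℝ → ℝ≥0∞) {L : ℝ} (hL : 0 < L) {t : ℝ} (ht : 0 < t)
    {g : Config N → ℝ≥0∞} (hg : Measurable g)
    (hper : ∀ (Y : Config N) (i : Fin N) (k : Fin 3),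
      g (Y + Pi.single i (EuclideanSpace.single k L)) = g Y) (X : Config N) :
    periodicFKSemigroup v L t g X ≤ pHeatConst N L t.toNNReal * ∫⁻ Y in cellN N L, g Y :=
  (periodicFKSemigroup_le_lintegral_worldLine v L t g X).trans
    (lintegral_worldLine_le_cell hL X (by simpa using ht) hg hper)

/-- **`L²(cell) → L^∞` bound for the periodic Feynman–Kac functional**: for periodic measurable
`g ≥ 0` and `t > 0`, `(e^{-tH} g)(X) ≤ pHeatConst N L t · |cell|^{1/2} · ‖g‖_{L²(cell)}`,
uniformly in `X`. [cite: ChungZhao1995, Thm 3.10] -/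
theorem periodicFKSemigroup_le_L2cell (v : ℝ → ℝ≥0∞) {L : ℝ} (hL : 0 < L) {t : ℝ} (ht : 0 < t)
    {g : Config N → ℝ≥0∞} (hg : Measurable g)
    (hper : ∀ (Y : Config N) (i : Fin N) (k : Fin 3),
      g (Y + Pi.single i (EuclideanSpace.single k L)) = g Y) (X : Config N) :
    periodicFKSemigroup v L t g X ≤
      pHeatConst N L t.toNNReal * volume (cellN N L) ^ (1 / 2 : ℝ) *
        (∫⁻ Y in cellN N L, g Y ^ (2 : ℝ)) ^ (1 / 2 : ℝ) :=
  (periodicFKSemigroup_le_lintegral_worldLine v L t g X).trans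
    (lintegral_worldLine_le_L2cell hL X (by simpa using ht) hg hper)

/-- The periodic Feynman–Kac functional of a periodic `L²(cell)` observable is finite at every
point (`t > 0`). [folklore] -/
theorem periodicFKSemigroup_lt_top_of_cell (v : ℝ → ℝ≥0∞) {L : ℝ} (hL : 0 < L) {t : ℝ}
    (ht : 0 < t) {g : Config N → ℝ≥0∞} (hg : Measurable g)
    (hper : ∀ (Y : Config N) (i : Fin N) (k : Fin 3),
      g (Y + Pi.single i (EuclideanSpace.single k L)) = g Y)
    (hg2 : ∫⁻ Y in cellN N L, g Y ^ (2 : ℝ) ≠ ⊤) (X : Config N) :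
    periodicFKSemigroup v L t g X < ⊤ := by
  refine (periodicFKSemigroup_le_L2cell v hL ht hg hper X).trans_lt ?_
  refine ENNReal.mul_lt_top (ENNReal.mul_lt_top (pHeatConst_lt_top N hL _) ?_) ?_
  · exact ENNReal.rpow_lt_top_of_nonneg (by norm_num) (volume_cellN_ne_top N L)
  · exact ENNReal.rpow_lt_top_of_nonneg (by norm_num) hg2

/-- The free expectation of a periodic `L¹(cell)` observable is finite (`t > 0`). [folklore] -/
theorem lintegral_worldLine_lt_top_of_cell {L : ℝ} (hL : 0 < L) (X : Config N) {t : ℝ≥0}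
    (ht : t ≠ 0) {G : Config N → ℝ≥0∞} (hG : Measurable G)
    (hper : ∀ (Y : Config N) (i : Fin N) (k : Fin 3),
      G (Y + Pi.single i (EuclideanSpace.single k L)) = G Y)
    (hG1 : ∫⁻ Y in cellN N L, G Y ≠ ⊤) :
    ∫⁻ ω, G (worldLine X ω t) ∂wienerPaths N < ⊤ :=
  (lintegral_worldLine_le_cell hL X ht hG hper).trans_lt
    (ENNReal.mul_lt_top (pHeatConst_lt_top N hL t) hG1.lt_top)

end Literature.MathematicalPhysics.QuantumManyBody.BoseGas

end
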